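import Literature.NumberTheory.EllipticCurves.PAdicLFunctionTameMult
import Literature.NumberTheory.EllipticCurves.PAdicLFunctionTameProofs
import HarnessLib

/-!
# The one-term tame measure (`ε(p) = 0`): change of tame level at a GOOD prime `ℓ` (Matsuno 2000, Lemma 2.2 with
# `ε(ℓ) = 1`, two-term form over all lifts AND the printed unit-class form) (PROOFS ONLY: no `def`, no named fact)

Companion of `PAdicLFunctionTameMult` (cell bsd-2adic, seat conv-1 GEN 13, road «hKan-mult»); the one-term twin of
`PAdicLFunctionTameProofs` §LevelChange/§Fiber and of `PAdicLFunctionTameUnitLevelChangeProofs`. The change of tame level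
`m ↦ mℓ` at a prime `ℓ ∤ pmN` involves only the Hecke relation at the GOOD prime `ℓ`
(`a_ℓ[x]⁺ = ∑_{u mod ℓ}[(x+u)/ℓ]⁺ + [ℓx]⁺`, tree theorem `intCast_mul_ratPlusSymbol`, packaged at the tame fractions as
`sum_ratPlusSymbol_tameFraction_lift`), so it is the SAME for the one-term measure at `p ∣ N` as for the two-term measure at
`p ∤ N` — one symbol instead of two:

* `sum_msdMeasureTameMult_lift`, `sum_filter_msdMeasureTameMult` — over ALL `ℓ` lifts `b' ↦ b`:
  `∑_{b' ↦ b} μ_{f,α,mℓ}((a + pⁿℤ_p) × {b'}) = a_ℓ·μ_{f,α,m}((a + pⁿℤ_p) × {b}) − μ_{f,α,m}((ℓa + pⁿℤ_p) × {ℓb})`;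
* `msdMeasureTameMult_lift_dvd` — the lift through `b' ≡ 0 (mod ℓ)`:
  `μ_{f,α,mℓ}((a + pⁿℤ_p) × {b'}) = μ_{f,α,m}((ℓ⁻¹a + pⁿℤ_p) × {ℓ⁻¹b})`;
* **`weighted_msdMeasureTameMult_levelChange`** — for the `𝟙`-weighted measure
  `W_m(n, a) = ∑_{b mod m} 𝟙_m(b) μ_{f,α,m}((a + pⁿℤ_p) × {b})`: `W_{mℓ}(n, a) = a_ℓ·W_m(n, a) − W_m(n, ℓa) − W_m(n, ℓ⁻¹a)`,
  the measure identity behind Matsuno's Lemma 3.3 (`h_ℓ = a_ℓ − (1+T)^{f_ℓ} − (1+T)^{−f_ℓ}` at a good `ℓ`, `ε(ℓ) = 1`).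

References: K. Matsuno, J. Number Theory 84 (2000), Lemma 2.2 (p. 85), Lemma 3.3 (pp. 87–88) [Matsuno2000]; B. Mazur,
P. Swinnerton-Dyer, Invent. Math. 25 (1974), §8 Lemma 2 [MazurSwinnertonDyer1974Invent]; B. Mazur, J. Tate, J. Teitelbaum,
Invent. Math. 84 (1986), §I.10 [MazurTateTeitelbaum1986Invent].
-/

noncomputable section

open scoped MatrixGroups ModularForm

open CongruenceSubgroup Filter Topology Literature.NumberTheory.EllipticCurves.ModularForms

namespace Literature.NumberTheory.EllipticCurves

/-! ## §1. Matsuno's Lemma 2.2 over all `ℓ` lifts, one-term measure -/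

section LevelChange

variable {N : ℕ} [NeZero N] (f : CuspForm (Gamma0 N) 2) {p : ℕ} [Fact p.Prime] {m ℓ n : ℕ}

/-- **Change of tame level, one-term measure** (Matsuno 2000 Lemma 2.2 / Mazur–Swinnerton-Dyer §8 Lemma 2, form over all
`ℓ` lifts): with `c` the CRT representative of `(a, b)` at level `m` and `b'_u = c + pⁿmu (mod mℓ)` the `ℓ` classes over `b`,
`∑_u μ_{f,α,mℓ}((a + pⁿℤ_p) × {b'_u}) = a_ℓ · μ_{f,α,m}((a + pⁿℤ_p) × {b}) − μ_{f,α,m}((ℓa + pⁿℤ_p) × {ℓb})` — the Hecke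
relation at the good prime `ℓ` (`sum_ratPlusSymbol_tameFraction_lift` with `k = 1`).
[cite: Matsuno2000, Lemma 2.2 (p. 85)] [cite: MazurSwinnertonDyer1974Invent, §8 Lemma 2] -/
theorem sum_msdMeasureTameMult_lift [NeZero m] [NeZero (m * ℓ)] (hf : IsNewform0 f)
    (hrat : ∀ r : ℚ, (ratPlusSymbol f r : ℝ) = normalizedPlusSymbol f r) (hℓ : ℓ.Prime) (hℓN : ¬ ℓ ∣ N)
    {aℓ : ℤ} (haℓ : cuspCoeff f ℓ = aℓ) (hmp : m.Coprime p) (hℓp : ℓ.Coprime p)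
    (α : ℚ_[p]) (a : ZMod (p ^ n)) (b : ZMod m) :
    ∑ u : Fin ℓ, msdMeasureTameMult f (m * ℓ) α n a ((tameRep p m n a b + p ^ n * m * (u : ℕ) : ℕ) : ZMod (m * ℓ)) =
      (aℓ : ℚ_[p]) * msdMeasureTameMult f m α n a b -
        msdMeasureTameMult f m α n (a * (ℓ : ZMod (p ^ n))) (b * (ℓ : ZMod m)) := by
  have hp : p.Prime := Fact.out
  have h1 := sum_ratPlusSymbol_tameFraction_lift (n := n) hp hf hrat hℓ hℓN haℓ hmp hℓp a b
    (Nat.coprime_one_left ℓ)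
  simp only [Nat.cast_one, one_mul] at h1
  have h1' := congrArg (fun q : ℚ => (q : ℚ_[p])) h1
  simp only [Rat.cast_sum, Rat.cast_sub, Rat.cast_mul, Rat.cast_intCast] at h1'
  simp only [msdMeasureTameMult, ← Finset.mul_sum, h1']
  ring

/-- **Matsuno 2000 Lemma 2.2 in fibre form, one-term measure**: for a prime `ℓ ∤ N` prime to `p` and to `m`,
`∑_{b' ↦ b} μ_{f,α,mℓ}((a + pⁿℤ_p) × {b'}) = a_ℓ μ_{f,α,m}((a + pⁿℤ_p) × {b}) − μ_{f,α,m}((ℓa + pⁿℤ_p) × {ℓb})`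
(`filter_castHom_eq_image_lift`). [cite: Matsuno2000, Lemma 2.2 (p. 85)] [cite: MazurSwinnertonDyer1974Invent, §8 Lemma 2] -/
theorem sum_filter_msdMeasureTameMult [NeZero m] [NeZero (m * ℓ)] (hf : IsNewform0 f)
    (hrat : ∀ r : ℚ, (ratPlusSymbol f r : ℝ) = normalizedPlusSymbol f r) (hℓ : ℓ.Prime) (hℓN : ¬ ℓ ∣ N)
    {aℓ : ℤ} (haℓ : cuspCoeff f ℓ = aℓ) (hmp : m.Coprime p) (hℓp : ℓ.Coprime p) (hℓm : ℓ.Coprime m)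
    (α : ℚ_[p]) (a : ZMod (p ^ n)) (b : ZMod m) :
    ∑ b' ∈ Finset.univ.filter (fun b' : ZMod (m * ℓ) => ZMod.castHom (dvd_mul_right m ℓ) (ZMod m) b' = b),
        msdMeasureTameMult f (m * ℓ) α n a b' =
      (aℓ : ℚ_[p]) * msdMeasureTameMult f m α n a b -
        msdMeasureTameMult f m α n (a * (ℓ : ZMod (p ^ n))) (b * (ℓ : ZMod m)) := by
  rw [filter_castHom_eq_image_lift hℓ hℓp hℓm hmp a b,
    Finset.sum_image fun u _ u' _ h => lift_injective (n := n) hℓp hℓm _ h]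
  exact sum_msdMeasureTameMult_lift f hf hrat hℓ hℓN haℓ hmp hℓp α a b

end LevelChange

/-! ## §2. The lift through `0 mod ℓ` -/

section LiftZero

variable {p m ℓ n : ℕ}

/-- Two naturals with the same residues mod pairwise coprime `pⁿ`, `m`, `ℓ` agree mod `pⁿmℓ`; private helper. [folklore] -/
private theorem intCast_dvd_sub_of_natCast_eq₃' (hmp : m.Coprime p) (hℓp : ℓ.Coprime p) (hℓm : ℓ.Coprime m)
    {c c' : ℕ} (h1 : (c : ZMod (p ^ n)) = c') (h2 : (c : ZMod m) = c') (h3 : (c : ZMod ℓ) = c') :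
    ((p ^ n * (m * ℓ) : ℕ) : ℤ) ∣ (c : ℤ) - c' := by
  have h1' : c ≡ c' [MOD p ^ n] := (ZMod.natCast_eq_natCast_iff _ _ _).mp h1
  have h2' : c ≡ c' [MOD m] := (ZMod.natCast_eq_natCast_iff _ _ _).mp h2
  have h3' : c ≡ c' [MOD ℓ] := (ZMod.natCast_eq_natCast_iff _ _ _).mp h3
  have h23 : c ≡ c' [MOD m * ℓ] := (Nat.modEq_and_modEq_iff_modEq_mul hℓm.symm).mp ⟨h2', h3'⟩
  have h : c ≡ c' [MOD p ^ n * (m * ℓ)] :=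
    (Nat.modEq_and_modEq_iff_modEq_mul (Nat.Coprime.mul_right (hmp.symm.pow_left n) (hℓp.symm.pow_left n))).mp
      ⟨h1', h23⟩
  exact Nat.modEq_iff_dvd.mp h.symm

variable {N : ℕ} [NeZero N] (f : CuspForm (Gamma0 N) 2) [Fact p.Prime]

/-- **The lift through `0 mod ℓ`, one-term measure** (the third term of Matsuno's Lemma 2.2): for `b' mod mℓ` over
`b mod m` with `b' ≡ 0 (mod ℓ)`, `μ_{f,α,mℓ}((a + pⁿℤ_p) × {b'}) = μ_{f,α,m}((ℓ⁻¹a + pⁿℤ_p) × {ℓ⁻¹b})`: the CRT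
representative `c'` of `(a, b')` is divisible by `ℓ` and `c'/ℓ` represents `(ℓ⁻¹a, ℓ⁻¹b)` at level `m`, so
`[c'/(pⁿmℓ)]⁺ = [(c'/ℓ)/(pⁿm)]⁺`. [cite: Matsuno2000, Lemma 2.2 (p. 85)] -/
theorem msdMeasureTameMult_lift_dvd [NeZero m] [NeZero (m * ℓ)] (hℓ : ℓ.Prime) (hmp : m.Coprime p)
    (hℓp : ℓ.Coprime p) (hℓm : ℓ.Coprime m) (α : ℚ_[p]) (a : ZMod (p ^ n)) (b : ZMod m) (b' : ZMod (m * ℓ))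
    (hb' : ZMod.castHom (dvd_mul_right m ℓ) (ZMod m) b' = b) (hb'ℓ : ZMod.castHom (dvd_mul_left ℓ m) (ZMod ℓ) b' = 0) :
    msdMeasureTameMult f (m * ℓ) α n a b' =
      msdMeasureTameMult f m α n (a * (ℓ : ZMod (p ^ n))⁻¹) (b * (ℓ : ZMod m)⁻¹) := by
  have hp : p.Prime := Fact.out
  haveI : NeZero (p ^ n) := ⟨pow_ne_zero _ hp.ne_zero⟩
  haveI : NeZero ℓ := ⟨hℓ.ne_zero⟩
  have hmℓp : (m * ℓ).Coprime p := Nat.Coprime.mul_left hmp hℓp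
  have hM1 : p ^ n * (m * ℓ) ≠ 0 := mul_ne_zero (pow_ne_zero _ hp.ne_zero) (mul_ne_zero (NeZero.ne m) hℓ.ne_zero)
  have hℓu_p : IsUnit (ℓ : ZMod (p ^ n)) := by
    rw [ZMod.isUnit_iff_coprime]; exact hℓp.pow_right n
  have hℓu_m : IsUnit (ℓ : ZMod m) := by
    rw [ZMod.isUnit_iff_coprime]; exact hℓm
  set c' := tameRep p (m * ℓ) n a b' with hc'
  set c'' := tameRep p m n (a * (ℓ : ZMod (p ^ n))⁻¹) (b * (ℓ : ZMod m)⁻¹) with hc''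
  have h1 : (c' : ZMod (p ^ n)) = ((ℓ * c'' : ℕ) : ZMod (p ^ n)) := by
    rw [hc', natCast_tameRep_left hp hmℓp, Nat.cast_mul, hc'', natCast_tameRep_left hp hmp, mul_comm,
      mul_assoc, ZMod.inv_mul_of_unit _ hℓu_p, mul_one]
  have h2 : (c' : ZMod m) = ((ℓ * c'' : ℕ) : ZMod m) := by
    have h := natCast_tameRep_right hmℓp a b'
    have hcm : (c' : ZMod m) = b := by
      have := congrArg (ZMod.castHom (dvd_mul_right m ℓ) (ZMod m)) h
      rwa [map_natCast, hb'] at this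
    rw [hcm, Nat.cast_mul, hc'', natCast_tameRep_right hmp, mul_comm, mul_assoc, ZMod.inv_mul_of_unit _ hℓu_m,
      mul_one]
  have h3 : (c' : ZMod ℓ) = ((ℓ * c'' : ℕ) : ZMod ℓ) := by
    have h := natCast_tameRep_right hmℓp a b'
    have hcℓ : (c' : ZMod ℓ) = 0 := by
      have := congrArg (ZMod.castHom (dvd_mul_left ℓ m) (ZMod ℓ)) h
      rwa [map_natCast, hb'ℓ] at this
    rw [hcℓ, Nat.cast_mul, ZMod.natCast_self, zero_mul]
  have hdvd := intCast_dvd_sub_of_natCast_eq₃' (n := n) hmp hℓp hℓm h1 h2 h3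
  have hL : tameFraction p (m * ℓ) n a b' = (1 : ℕ) * (((c' : ℤ) : ℚ) / ((p ^ n * (m * ℓ) : ℕ) : ℚ)) := by
    rw [tameFraction, ← hc']
    push_cast
    ring
  have hR : tameFraction p m n (a * (ℓ : ZMod (p ^ n))⁻¹) (b * (ℓ : ZMod m)⁻¹) =
      (1 : ℕ) * ((((ℓ * c'' : ℕ) : ℤ) : ℚ) / ((p ^ n * (m * ℓ) : ℕ) : ℚ)) := by
    have hℓ0 : (ℓ : ℚ) ≠ 0 := by exact_mod_cast hℓ.ne_zero
    rw [tameFraction, ← hc'']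
    push_cast
    field_simp
  rw [msdMeasureTameMult, msdMeasureTameMult, hL, hR, ratPlusSymbol_mul_div_eq_of_dvd_sub f hM1 hdvd 1]

end LiftZero

/-! ## §3. The level change of the `𝟙`-weighted one-term measure (unit-class form of Lemma 2.2) -/

section Weighted

variable {p m ℓ n : ℕ}

/-- Two classes mod `mℓ` with the same residues mod `m` and mod `ℓ` (coprime) coincide; private helper. [folklore] -/
private theorem eq_of_castHom_eq_castHom' [NeZero (m * ℓ)] (hℓm : ℓ.Coprime m) {x y : ZMod (m * ℓ)}
    (hm : ZMod.castHom (dvd_mul_right m ℓ) (ZMod m) x = ZMod.castHom (dvd_mul_right m ℓ) (ZMod m) y)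
    (hℓ : ZMod.castHom (dvd_mul_left ℓ m) (ZMod ℓ) x = ZMod.castHom (dvd_mul_left ℓ m) (ZMod ℓ) y) : x = y := by
  rw [← ZMod.natCast_zmod_val x, ← ZMod.natCast_zmod_val y] at hm hℓ ⊢
  rw [map_natCast, map_natCast] at hm hℓ
  have h1 : x.val ≡ y.val [MOD m] := (ZMod.natCast_eq_natCast_iff _ _ _).mp hm
  have h2 : x.val ≡ y.val [MOD ℓ] := (ZMod.natCast_eq_natCast_iff _ _ _).mp hℓ
  exact (ZMod.natCast_eq_natCast_iff _ _ _).mpr ((Nat.modEq_and_modEq_iff_modEq_mul hℓm.symm).mp ⟨h1, h2⟩)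

/-- A class mod `mℓ` is a unit iff its residues mod `m` and mod `ℓ` are units; private helper. [folklore] -/
private theorem isUnit_iff_isUnit_castHom_and' [NeZero m] [NeZero ℓ] [NeZero (m * ℓ)] (x : ZMod (m * ℓ)) :
    IsUnit x ↔ IsUnit (ZMod.castHom (dvd_mul_right m ℓ) (ZMod m) x) ∧
      IsUnit (ZMod.castHom (dvd_mul_left ℓ m) (ZMod ℓ) x) := by
  obtain ⟨k, rfl⟩ : ∃ k : ℕ, (k : ZMod (m * ℓ)) = x := ⟨x.val, ZMod.natCast_zmod_val x⟩
  rw [map_natCast, map_natCast, ZMod.isUnit_iff_coprime, ZMod.isUnit_iff_coprime, ZMod.isUnit_iff_coprime,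
    Nat.coprime_mul_iff_right]

/-- The lift of `b mod m` to the class `≡ 0 (mod ℓ)` of `ℤ/mℓ`: `ℓ · (bℓ⁻¹)`; private helper. [folklore] -/
private theorem castHom_liftZero' [NeZero m] [NeZero (m * ℓ)] (hℓm : ℓ.Coprime m) (b : ZMod m) :
    ZMod.castHom (dvd_mul_right m ℓ) (ZMod m) ((ℓ : ZMod (m * ℓ)) * (((b * (ℓ : ZMod m)⁻¹).val : ℕ) : ZMod (m * ℓ))) = b ∧
    ZMod.castHom (dvd_mul_left ℓ m) (ZMod ℓ) ((ℓ : ZMod (m * ℓ)) * (((b * (ℓ : ZMod m)⁻¹).val : ℕ) : ZMod (m * ℓ))) = 0 := by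
  have hℓu : IsUnit (ℓ : ZMod m) := by rw [ZMod.isUnit_iff_coprime]; exact hℓm
  constructor
  · rw [map_mul, map_natCast, map_natCast, ZMod.natCast_zmod_val, mul_comm, mul_assoc, ZMod.inv_mul_of_unit _ hℓu,
      mul_one]
  · rw [map_mul, map_natCast, ZMod.natCast_self, zero_mul]

/-- The classes `≡ 0 (mod ℓ)` of `ℤ/mℓ` are the lifts `ℓ·(bℓ⁻¹)`, `b ∈ ℤ/m`; private helper. [folklore] -/
private theorem filter_castHom_ell_eq_zero_eq_image' [NeZero m] [NeZero (m * ℓ)] (hℓm : ℓ.Coprime m) :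
    Finset.univ.filter (fun b' : ZMod (m * ℓ) => ZMod.castHom (dvd_mul_left ℓ m) (ZMod ℓ) b' = 0) =
      Finset.univ.image (fun b : ZMod m => (ℓ : ZMod (m * ℓ)) * (((b * (ℓ : ZMod m)⁻¹).val : ℕ) : ZMod (m * ℓ))) := by
  classical
  ext b'
  simp only [Finset.mem_filter, Finset.mem_univ, true_and, Finset.mem_image]
  constructor
  · intro hb'
    refine ⟨ZMod.castHom (dvd_mul_right m ℓ) (ZMod m) b', ?_⟩
    obtain ⟨h1, h2⟩ := castHom_liftZero' (ℓ := ℓ) hℓm (ZMod.castHom (dvd_mul_right m ℓ) (ZMod m) b')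
    exact eq_of_castHom_eq_castHom' hℓm h1 (h2.trans hb'.symm)
  · rintro ⟨b, rfl⟩
    exact (castHom_liftZero' hℓm b).2

variable {N : ℕ} [NeZero N] (f : CuspForm (Gamma0 N) 2) [Fact p.Prime]

/-- **Level change of the `𝟙`-weighted one-term tame measure** (Matsuno 2000 Lemma 2.2 in its printed unit-class form,
summed over the units — the identity behind Lemma 3.3; `ε(ℓ) = 1` at the good prime `ℓ`): with
`W_m(n, a) = ∑_{b mod m} 𝟙_m(b) μ_{f,α,m}((a + pⁿℤ_p) × {b})`, for a prime `ℓ ∤ N` prime to `p` and to `m`: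
`W_{mℓ}(n, a) = a_ℓ·W_m(n, a) − W_m(n, ℓa) − W_m(n, ℓ⁻¹a)`.
[cite: Matsuno2000, Lemma 2.2 (p. 85) and Lemma 3.3 (pp. 87–88)] [cite: MazurSwinnertonDyer1974Invent, §8 Lemma 2] -/
theorem weighted_msdMeasureTameMult_levelChange [NeZero m] [NeZero (m * ℓ)] (hf : IsNewform0 f)
    (hrat : ∀ r : ℚ, (ratPlusSymbol f r : ℝ) = normalizedPlusSymbol f r) (hℓ : ℓ.Prime) (hℓN : ¬ ℓ ∣ N)
    {aℓ : ℤ} (haℓ : cuspCoeff f ℓ = aℓ) (hmp : m.Coprime p) (hℓp : ℓ.Coprime p) (hℓm : ℓ.Coprime m)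
    (α : ℚ_[p]) (a : ZMod (p ^ n)) :
    ∑ b' : ZMod (m * ℓ), (1 : DirichletCharacter ℚ_[p] (m * ℓ)) b' * msdMeasureTameMult f (m * ℓ) α n a b' =
      (aℓ : ℚ_[p]) * ∑ b : ZMod m, (1 : DirichletCharacter ℚ_[p] m) b * msdMeasureTameMult f m α n a b -
        ∑ b : ZMod m, (1 : DirichletCharacter ℚ_[p] m) b * msdMeasureTameMult f m α n (a * (ℓ : ZMod (p ^ n))) b -
        ∑ b : ZMod m, (1 : DirichletCharacter ℚ_[p] m) b *
          msdMeasureTameMult f m α n (a * (ℓ : ZMod (p ^ n))⁻¹) b := by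
  classical
  haveI : NeZero ℓ := ⟨hℓ.ne_zero⟩
  haveI : Fact ℓ.Prime := ⟨hℓ⟩
  have hℓu : IsUnit (ℓ : ZMod m) := by rw [ZMod.isUnit_iff_coprime]; exact hℓm
  -- Step A: `𝟙_{mℓ}(b') = 𝟙_m(b̄') − [ℓ ∣ b']·𝟙_m(b̄')`
  have hA : ∀ b' : ZMod (m * ℓ), (1 : DirichletCharacter ℚ_[p] (m * ℓ)) b' =
      (1 : DirichletCharacter ℚ_[p] m) (ZMod.castHom (dvd_mul_right m ℓ) (ZMod m) b') -
        (if ZMod.castHom (dvd_mul_left ℓ m) (ZMod ℓ) b' = 0 then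
          (1 : DirichletCharacter ℚ_[p] m) (ZMod.castHom (dvd_mul_right m ℓ) (ZMod m) b') else 0) := by
    intro b'
    by_cases h0 : ZMod.castHom (dvd_mul_left ℓ m) (ZMod ℓ) b' = 0
    · have hnu : ¬ IsUnit b' := fun hu => by
        have := ((isUnit_iff_isUnit_castHom_and' b').mp hu).2
        rw [h0] at this
        exact not_isUnit_zero this
      rw [MulChar.map_nonunit _ hnu, if_pos h0, sub_self]
    · rw [if_neg h0, sub_zero]
      have huℓ : IsUnit (ZMod.castHom (dvd_mul_left ℓ m) (ZMod ℓ) b') := isUnit_iff_ne_zero.mpr h0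
      by_cases hum : IsUnit (ZMod.castHom (dvd_mul_right m ℓ) (ZMod m) b')
      · have hu : IsUnit b' := (isUnit_iff_isUnit_castHom_and' b').mpr ⟨hum, huℓ⟩
        obtain ⟨v, hv'⟩ := hum
        obtain ⟨u, hu'⟩ := hu
        rw [← hv', MulChar.one_apply_coe, ← hu', MulChar.one_apply_coe]
      · have hnu : ¬ IsUnit b' := fun hu => hum ((isUnit_iff_isUnit_castHom_and' b').mp hu).1
        rw [MulChar.map_nonunit _ hnu, MulChar.map_nonunit _ hum]
  simp_rw [hA, sub_mul, Finset.sum_sub_distrib, ite_mul, zero_mul, ← Finset.sum_filter]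
  -- Step B: the first sum, fibrewise over `b mod m`
  have hB : ∑ b' : ZMod (m * ℓ), (1 : DirichletCharacter ℚ_[p] m) (ZMod.castHom (dvd_mul_right m ℓ) (ZMod m) b') *
      msdMeasureTameMult f (m * ℓ) α n a b' =
      ∑ b : ZMod m, (1 : DirichletCharacter ℚ_[p] m) b *
        ((aℓ : ℚ_[p]) * msdMeasureTameMult f m α n a b -
          msdMeasureTameMult f m α n (a * (ℓ : ZMod (p ^ n))) (b * (ℓ : ZMod m))) := by
    rw [← Finset.sum_fiberwise Finset.univ (ZMod.castHom (dvd_mul_right m ℓ) (ZMod m))]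
    refine Finset.sum_congr rfl fun b _ => ?_
    rw [← sum_filter_msdMeasureTameMult f hf hrat hℓ hℓN haℓ hmp hℓp hℓm α a b, Finset.mul_sum]
    refine Finset.sum_congr rfl fun b' hb' => ?_
    rw [(Finset.mem_filter.mp hb').2]
  -- Step C: the second sum, over the classes `≡ 0 (mod ℓ)`
  have hinj : Function.Injective
      (fun b : ZMod m => (ℓ : ZMod (m * ℓ)) * (((b * (ℓ : ZMod m)⁻¹).val : ℕ) : ZMod (m * ℓ))) := by
    intro b₁ b₂ h
    have h1 := (castHom_liftZero' (ℓ := ℓ) hℓm b₁).1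
    have h2 := (castHom_liftZero' (ℓ := ℓ) hℓm b₂).1
    have := congrArg (ZMod.castHom (dvd_mul_right m ℓ) (ZMod m)) h
    simp only at this
    rw [h1, h2] at this
    exact this
  have hC : ∑ b' ∈ Finset.univ.filter (fun b' : ZMod (m * ℓ) => ZMod.castHom (dvd_mul_left ℓ m) (ZMod ℓ) b' = 0),
      (1 : DirichletCharacter ℚ_[p] m) (ZMod.castHom (dvd_mul_right m ℓ) (ZMod m) b') *
        msdMeasureTameMult f (m * ℓ) α n a b' =
      ∑ b : ZMod m, (1 : DirichletCharacter ℚ_[p] m) b *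
        msdMeasureTameMult f m α n (a * (ℓ : ZMod (p ^ n))⁻¹) (b * (ℓ : ZMod m)⁻¹) := by
    rw [filter_castHom_ell_eq_zero_eq_image' hℓm, Finset.sum_image fun b₁ _ b₂ _ h => hinj h]
    refine Finset.sum_congr rfl fun b _ => ?_
    obtain ⟨h1, h2⟩ := castHom_liftZero' (ℓ := ℓ) hℓm b
    rw [h1, msdMeasureTameMult_lift_dvd f hℓ hmp hℓp hℓm α a b _ h1 h2]
  rw [hB, hC]
  -- Step D: reindex `b ↦ bℓ` and `b ↦ bℓ⁻¹`
  have hone : ∀ b : ZMod m, ∀ v : (ZMod m)ˣ, (1 : DirichletCharacter ℚ_[p] m) (b * (v : ZMod m)) =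
      (1 : DirichletCharacter ℚ_[p] m) b := by
    intro b v
    rw [map_mul, MulChar.one_apply_coe, mul_one]
  have hD1 : ∑ b : ZMod m, (1 : DirichletCharacter ℚ_[p] m) b *
      msdMeasureTameMult f m α n (a * (ℓ : ZMod (p ^ n))) (b * (ℓ : ZMod m)) =
      ∑ b : ZMod m, (1 : DirichletCharacter ℚ_[p] m) b * msdMeasureTameMult f m α n (a * (ℓ : ZMod (p ^ n))) b := by
    refine Fintype.sum_bijective (· * (ℓ : ZMod m)) (Units.mulRight hℓu.unit).bijective _ _ fun b => ?_
    rw [← hone (b * (ℓ : ZMod m)) hℓu.unit⁻¹, mul_assoc, IsUnit.mul_val_inv, mul_one]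
  have hD2 : ∑ b : ZMod m, (1 : DirichletCharacter ℚ_[p] m) b *
      msdMeasureTameMult f m α n (a * (ℓ : ZMod (p ^ n))⁻¹) (b * (ℓ : ZMod m)⁻¹) =
      ∑ b : ZMod m, (1 : DirichletCharacter ℚ_[p] m) b *
        msdMeasureTameMult f m α n (a * (ℓ : ZMod (p ^ n))⁻¹) b := by
    have hinv : (ℓ : ZMod m)⁻¹ = ((hℓu.unit⁻¹ : (ZMod m)ˣ) : ZMod m) := by
      rw [← ZMod.inv_coe_unit, IsUnit.unit_spec]
    refine Fintype.sum_bijective (· * (ℓ : ZMod m)⁻¹) ?_ _ _ fun b => ?_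
    · rw [hinv]; exact (Units.mulRight (hℓu.unit⁻¹)).bijective
    · rw [hinv, ← hone (b * ((hℓu.unit⁻¹ : (ZMod m)ˣ) : ZMod m)) hℓu.unit, mul_assoc, Units.inv_mul, mul_one]
  rw [Finset.mul_sum]
  simp_rw [mul_sub, Finset.sum_sub_distrib, ← mul_assoc, mul_comm _ (aℓ : ℚ_[p]), mul_assoc]
  rw [hD1, hD2]

end Weighted

end Literature.NumberTheory.EllipticCurves

end
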